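import Literature.NumberTheory.ModularForms.PoincareSeriesWeightTwoHeckeConvergence
import Literature.NumberTheory.ModularForms.PoincareSeriesWeightTwoModeIntegral
import Literature.NumberTheory.LFunctions.KloostermanWeilPrimeProofs
import Literature.NumberTheory.Sieve.DivisorBound
import Mathlib.Analysis.Fourier.AddCircle
import HarnessLib

/-!
# Hecke's limit `s → 0⁺` for the weight-2 Poincaré series of `Γ₀(N)`, pointwise, from its
# Fourier modes (Iwaniec–Kowalski Lemma 14.2 at `k = 2`, Hecke's trick §3.2)

Topic `Literature/NumberTheory/ModularForms` (namespace `Literature.NumberTheory.ModularForms.PoincareWeightTwo`,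
continuing `PoincareSeriesWeightTwoHecke.lean` (definitions), `…HeckeConvergence.lean` (T1: absolute
convergence, automorphy, majorants) and `…ModeIntegral.lean` (the cell integral `I_s(A,B;y)`)).
THEOREMS, plus two definitions with bodies: `cellTerm` (the `r`-th Kloosterman cell of the `n`-th
Fourier mode — the SAME body as the local `cellTerm` of the I1 skeleton
`Summits/Parity/GeneralizedHardyLittlewood/Cruxes/PeterssonBoundPrinted/Lines/poincare_hecke.lean`) and
`fourierMode` (the printed right-hand side of the mode formula). No named fact.

The theorem `heckeLimit_of_fourierModes` is the registered stub **T3 `stub_heckeLimit :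
HeckeFourierModes → HeckeLimit`** of that skeleton (Kowalski–Michel 2000, Petersson's formula at
prime level and weight 2, stmt-Parity-20404), hypothesis and conclusion VERBATIM:

* hypothesis (T2, the Fourier modes along `Im z = y`, `s > 0`):
  `∫₀¹ P_m(x+iy,s) e(−nx) dx = δ_{mn} e^{−2πmy} + Σ_{r≥1} (Nr)^{−2−2s} S(m,n;Nr) I_s(m/(Nr)², n; y)`;
* conclusion: `P_m(z,s) → Σ_{n≥1} p_m(n) e(nz)` as `s → 0⁺`, `p_m(n) = poincareCoeff N m n
  = δ(m,n) − √n/√m · J_N(m,n)`.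

Proof (as in print, made quantitative): (1) for `s > 0`, `x ↦ P_m(x+iy,s)` is continuous
(Eisenstein majorant on a vertical strip) and `1`-periodic (automorphy under `T`), and its Fourier
coefficients — the modes — are `O(e^{−π|n|y})` by Weil's bound `|S(m,n;c)| ≤ (m,n,c)^{1/2}c^{1/2}τ(c)`
(the tree's theorem `weil_kloosterman_bound_holds`), the divisor bound, and the exponential decay
`‖I_s(A,n;y)‖ ≤ (2π/y)(y/2)^{−2s}e^{−π|n|y}` of the cell integral (contour shift); so the Fourier
series converges to `P_m(z,s)` pointwise (Mathlib `has_pointwise_sum_fourier_series_of_summable`).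
(2) The same majorant is uniform in `0 < s ≤ 1`, so `lim_{s→0⁺}` passes inside the `n`- and the
`r`-sums (Tannery). (3) At `s = 0` the cell integral is `e^{−2πny}(−2π√n(Nr)/√m)J₁(4π√(mn)/(Nr))`
for `n ≥ 1` (Lipschitz–Hankel, the tree's `weightTwo_besselModeIntegral`) and `0` for `n ≤ 0`, which
turns the `r`-sum into `−(√n/√m) e^{−2πny} J_N(m,n)` with Kowalski–Michel's
`J_N(m,n) = petJ N m n = (2π/N) Σ_r r⁻¹ S(m,n;Nr) J₁(4π√(mn)/(Nr))`.

## References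

* [IwaniecKowalski2004] H. Iwaniec, E. Kowalski, *Analytic Number Theory*, AMS Colloq. Publ. 53,
  Lemma 14.2 (proof), §3.2 (Hecke's trick), §14.1 (14.4).
* [Iwaniec2002] H. Iwaniec, *Spectral Methods of Automorphic Forms*, §2.5 (2.25) (Weil's bound),
  §3.2.
* [KowalskiMichel2000] E. Kowalski, P. Michel, Acta Arith. 94 (2000), §2.4.2 p. 312 (`J(l₁,l₂)`).
-/

noncomputable section

open scoped MatrixGroups Real Topology
open CongruenceSubgroup Complex MeasureTheory Filter Set
open UpperHalfPlane hiding I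
open Literature.NumberTheory.LFunctions (kloostermanSum weil_kloosterman_bound_holds)
open Literature.NumberTheory.LFunctions.KowalskiMichel2000 (petJ petKloostermanTerm
  petKloostermanTerm_zero petKloostermanTerm_of_ne_zero)

namespace Literature.NumberTheory.ModularForms.PoincareWeightTwo

/-! ## The cell term and the mode -/

/-- The `r`-th cell term `c^{−2−2s} S(m,n;c) I_s(m/c², n; y)` at `c = Nr` (`0` at `r = 0`) of the
`n`-th Fourier mode of `poincareHecke` along `Im z = y` (Iwaniec–Kowalski §14.2, proof of Lemma 14.2;
the same body as the local `cellTerm` of the I1 skeleton `poincare_hecke`).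
[cite: IwaniecKowalski2004, §14.2 (proof of Lemma 14.2)] -/
def cellTerm (N : ℕ) [NeZero N] (m : ℕ) (s : ℝ) (n : ℤ) (y : ℝ) (r : ℕ) : ℂ :=
  if h : r = 0 then 0 else
    haveI : NeZero (N * r) := ⟨mul_ne_zero (NeZero.ne N) h⟩
    (((N * r : ℕ) : ℂ) ^ 2)⁻¹ * ((((N * r : ℕ) : ℝ) ^ (-(2 * s)) : ℝ) : ℂ) *
      kloostermanSum (N * r) ((m : ℤ) : ZMod (N * r)) ((n : ℤ) : ZMod (N * r)) *
        modeIntegral s ((m : ℝ) / ((N * r : ℕ) : ℝ) ^ 2) n y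

/-- The printed `n`-th Fourier mode of `P_m(·+iy, s)`:
`δ_{mn} e^{−2πmy} + Σ_{r ≥ 1} (Nr)^{−2−2s} S(m,n;Nr) I_s(m/(Nr)², n; y)` (Iwaniec–Kowalski, proof of
Lemma 14.2, at `k = 2` with Hecke's factor). [cite: IwaniecKowalski2004, §14.2 (proof of Lemma 14.2)] -/
def fourierMode (N : ℕ) [NeZero N] (m : ℕ) (s : ℝ) (n : ℤ) (y : ℝ) : ℂ :=
  (if n = (m : ℤ) then cexp (-(2 * π * m * y)) else 0) + ∑' r : ℕ, cellTerm N m s n y r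

section Fixed

variable {N : ℕ} [NeZero N]

/-- The cell term at `r = 0` is `0`. [cite: IwaniecKowalski2004, §14.2 (proof of Lemma 14.2)] -/
@[simp] theorem cellTerm_zero (m : ℕ) (s : ℝ) (n : ℤ) (y : ℝ) : cellTerm N m s n y 0 = 0 := by
  simp [cellTerm]

/-- Unfolding the cell term at `r ≠ 0`. [cite: IwaniecKowalski2004, §14.2 (proof of Lemma 14.2)] -/
theorem cellTerm_of_ne_zero (m : ℕ) (s : ℝ) (n : ℤ) (y : ℝ) {r : ℕ} (hr : r ≠ 0) :
    cellTerm N m s n y r =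
      haveI : NeZero (N * r) := ⟨mul_ne_zero (NeZero.ne N) hr⟩
      (((N * r : ℕ) : ℂ) ^ 2)⁻¹ * ((((N * r : ℕ) : ℝ) ^ (-(2 * s)) : ℝ) : ℂ) *
        kloostermanSum (N * r) ((m : ℤ) : ZMod (N * r)) ((n : ℤ) : ZMod (N * r)) *
          modeIntegral s ((m : ℝ) / ((N * r : ℕ) : ℝ) ^ 2) n y := by
  simp [cellTerm, hr]

/-! ## The Kloosterman–divisor majorant of the cells (Weil's bound) -/

/-- The majorant `√m · τ(Nr) · (Nr)⁻² √(Nr)` of `|(Nr)^{−2−2s} S(m,n;Nr)|`, uniform in `n ∈ ℤ` and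
`s ≥ 0` (Weil: `|S(m,n;c)| ≤ (m,n,c)^{1/2} c^{1/2} τ(c)` and `(m,n,c) ≤ m`).
[cite: Iwaniec2002, §2.5 (2.25)] -/
def cellMajorant (N m r : ℕ) : ℝ :=
  Real.sqrt m * ((N * r : ℕ).divisors.card : ℝ) * ((((N * r : ℕ) : ℝ) ^ 2)⁻¹ * Real.sqrt ((N * r : ℕ) : ℝ))

omit [NeZero N] in
/-- `cellMajorant` is non-negative. [cite: Iwaniec2002, §2.5 (2.25)] -/
theorem cellMajorant_nonneg (m r : ℕ) : 0 ≤ cellMajorant N m r := by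
  unfold cellMajorant; positivity

/-- **Weil's bound on the arithmetic part of a cell**: for `m ≥ 1`, `s ≥ 0`, `r ≠ 0`, every `n ∈ ℤ`,
`|(Nr)⁻² (Nr)^{−2s} S(m,n;Nr)| ≤ √m τ(Nr) (Nr)⁻² √(Nr)`. [cite: Iwaniec2002, §2.5 (2.25)] -/
theorem norm_cell_arith_le {m : ℕ} (hm : 1 ≤ m) {s : ℝ} (hs : 0 ≤ s) (n : ℤ) {r : ℕ} (hr : r ≠ 0) :
    haveI : NeZero (N * r) := ⟨mul_ne_zero (NeZero.ne N) hr⟩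
    ‖(((N * r : ℕ) : ℂ) ^ 2)⁻¹ * ((((N * r : ℕ) : ℝ) ^ (-(2 * s)) : ℝ) : ℂ) *
        kloostermanSum (N * r) ((m : ℤ) : ZMod (N * r)) ((n : ℤ) : ZMod (N * r))‖ ≤
      cellMajorant N m r := by
  haveI : NeZero (N * r) := ⟨mul_ne_zero (NeZero.ne N) hr⟩
  set c : ℕ := N * r with hc
  have hc0 : c ≠ 0 := mul_ne_zero (NeZero.ne N) hr
  have hc1 : (1 : ℝ) ≤ c := by exact_mod_cast Nat.one_le_iff_ne_zero.mpr hc0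
  -- Weil's bound with the gcd reduced to `m`
  have hW := weil_kloosterman_bound_holds c (m : ℤ) n
  have hgcd : (Nat.gcd (Nat.gcd (m : ℤ).natAbs n.natAbs) c : ℝ) ≤ m := by
    have h1 : Nat.gcd (Nat.gcd (m : ℤ).natAbs n.natAbs) c ∣ m := by
      rw [Int.natAbs_natCast]
      exact Nat.dvd_trans (Nat.gcd_dvd_left _ _) (Nat.gcd_dvd_left _ _)
    exact_mod_cast Nat.le_of_dvd (by omega) h1
  have hS : ‖kloostermanSum c ((m : ℤ) : ZMod c) (n : ZMod c)‖ ≤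
      Real.sqrt m * Real.sqrt c * (c.divisors.card : ℝ) := by
    refine hW.trans ?_
    gcongr
  have h1 : ‖(((c : ℕ) : ℂ) ^ 2)⁻¹‖ = (((c : ℕ) : ℝ) ^ 2)⁻¹ := by
    rw [norm_inv, norm_pow, Complex.norm_natCast]
  have h2 : ‖((((c : ℕ) : ℝ) ^ (-(2 * s)) : ℝ) : ℂ)‖ ≤ 1 := by
    rw [Complex.norm_real, Real.norm_of_nonneg (Real.rpow_nonneg (by positivity) _)]
    exact Real.rpow_le_one_of_one_le_of_nonpos hc1 (by linarith)
  rw [norm_mul, norm_mul, h1]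
  calc (((c : ℕ) : ℝ) ^ 2)⁻¹ * ‖((((c : ℕ) : ℝ) ^ (-(2 * s)) : ℝ) : ℂ)‖ *
        ‖kloostermanSum c ((m : ℤ) : ZMod c) (n : ZMod c)‖
      ≤ (((c : ℕ) : ℝ) ^ 2)⁻¹ * 1 * (Real.sqrt m * Real.sqrt c * (c.divisors.card : ℝ)) := by
        gcongr
    _ = cellMajorant N m r := by rw [cellMajorant, ← hc]; ring

omit [NeZero N] in
/-- `c⁻² √c · c^{1/4} = c^{−5/4}` for `c > 0`. [folklore] -/
private theorem inv_sq_mul_sqrt_mul_rpow {c : ℝ} (hc : 0 < c) :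
    (c ^ 2)⁻¹ * Real.sqrt c * c ^ (1 / 4 : ℝ) = c ^ (-(5 / 4 : ℝ)) := by
  have h1 : (c ^ 2)⁻¹ = c ^ (-(2 : ℝ)) := by
    rw [Real.rpow_neg hc.le, Real.rpow_two]
  rw [h1, Real.sqrt_eq_rpow, ← Real.rpow_add hc, ← Real.rpow_add hc]
  norm_num

/-- **The cell majorant is summable over `r`** (divisor bound `τ(c) ≤ C c^{1/4}` makes it
`≤ C√m (Nr)^{−5/4}`). [cite: Iwaniec2002, §2.5 (2.25)] -/
theorem summable_cellMajorant (N : ℕ) [NeZero N] (m : ℕ) : Summable (cellMajorant N m) := by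
  obtain ⟨C, hC1, hC⟩ :=
    Literature.NumberTheory.Sieve.exists_card_divisors_le_mul_rpow' (by norm_num : (0 : ℝ) < 1 / 4)
  have hN : (0 : ℝ) < N := by exact_mod_cast Nat.pos_of_ne_zero (NeZero.ne N)
  have hmaj : Summable fun r : ℕ ↦
      C * Real.sqrt m * (N : ℝ) ^ (-(5 / 4 : ℝ)) * (r : ℝ) ^ (-(5 / 4 : ℝ)) :=
    (Real.summable_nat_rpow.mpr (by norm_num)).mul_left _
  refine Summable.of_nonneg_of_le (cellMajorant_nonneg (N := N) m) (fun r ↦ ?_) hmaj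
  rcases eq_or_ne r 0 with rfl | hr
  · simp [cellMajorant]
  have hc : (0 : ℝ) < ((N * r : ℕ) : ℝ) := by
    exact_mod_cast Nat.pos_of_ne_zero (mul_ne_zero (NeZero.ne N) hr)
  have hτ := hC (N * r)
  calc cellMajorant N m r
      ≤ Real.sqrt m * (C * ((N * r : ℕ) : ℝ) ^ (1 / 4 : ℝ)) *
          ((((N * r : ℕ) : ℝ) ^ 2)⁻¹ * Real.sqrt ((N * r : ℕ) : ℝ)) := by
        unfold cellMajorant
        gcongr
    _ = C * Real.sqrt m * (((((N * r : ℕ) : ℝ) ^ 2)⁻¹ * Real.sqrt ((N * r : ℕ) : ℝ)) *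
          ((N * r : ℕ) : ℝ) ^ (1 / 4 : ℝ)) := by ring
    _ = C * Real.sqrt m * ((N : ℝ) * r) ^ (-(5 / 4 : ℝ)) := by
        rw [inv_sq_mul_sqrt_mul_rpow hc]; push_cast; ring
    _ = C * Real.sqrt m * (N : ℝ) ^ (-(5 / 4 : ℝ)) * (r : ℝ) ^ (-(5 / 4 : ℝ)) := by
        rw [Real.mul_rpow hN.le (by positivity)]; ring

/-! ## The size of a cell, uniformly in `0 ≤ s ≤ 1` -/

/-- The constant `(2π/y)·max(1, (y/2)⁻²)` of the cell-integral bound on `0 ≤ s ≤ 1`.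
[cite: IwaniecKowalski2004, §14.2 (proof of Lemma 14.2)] -/
def modeConst (y : ℝ) : ℝ := 2 * π / y * max 1 ((y / 2) ^ (-2 : ℝ))

omit [NeZero N] in
/-- `modeConst y ≥ 0` for `y > 0`. [cite: IwaniecKowalski2004, §14.2 (proof of Lemma 14.2)] -/
theorem modeConst_nonneg {y : ℝ} (hy : 0 < y) : 0 ≤ modeConst y := by
  unfold modeConst; positivity

omit [NeZero N] in
/-- `(y/2)^{−2s} ≤ max(1, (y/2)⁻²)` for `0 ≤ s ≤ 1`, `y > 0`. [folklore] -/
private theorem rpow_half_le_max {y s : ℝ} (hy : 0 < y) (hs0 : 0 ≤ s) (hs1 : s ≤ 1) :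
    (y / 2) ^ (-(2 * s)) ≤ max 1 ((y / 2) ^ (-2 : ℝ)) := by
  have hy2 : 0 < y / 2 := by positivity
  rcases le_or_gt 1 (y / 2) with h | h
  · exact (Real.rpow_le_one_of_one_le_of_nonpos h (by linarith)).trans (le_max_left _ _)
  · exact (Real.rpow_le_rpow_of_exponent_ge hy2 h.le (by linarith)).trans (le_max_right _ _)

omit [NeZero N] in
/-- **The cell integral on `0 ≤ s ≤ 1`**: `‖I_s(A, B; y)‖ ≤ modeConst y · e^{−π|B|y}` (`A ≥ 0`).
[cite: IwaniecKowalski2004, §14.2 (proof of Lemma 14.2)] -/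
theorem norm_modeIntegral_le_modeConst {s A y : ℝ} (hs0 : 0 ≤ s) (hs1 : s ≤ 1) (hA : 0 ≤ A)
    (hy : 0 < y) (B : ℝ) :
    ‖modeIntegral s A B y‖ ≤ modeConst y * Real.exp (-(π * |B| * y)) := by
  refine (norm_modeIntegral_le hs0 hA hy B).trans ?_
  unfold modeConst
  gcongr
  exact rpow_half_le_max hy hs0 hs1

/-- **The size of a cell, uniformly in `0 ≤ s ≤ 1` and `n ∈ ℤ`:**
`‖cellTerm N m s n y r‖ ≤ cellMajorant N m r · modeConst y · e^{−π|n|y}`.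
[cite: IwaniecKowalski2004, §14.2 (proof of Lemma 14.2)] -/
theorem norm_cellTerm_le {m : ℕ} (hm : 1 ≤ m) {s : ℝ} (hs0 : 0 ≤ s) (hs1 : s ≤ 1) (n : ℤ)
    {y : ℝ} (hy : 0 < y) (r : ℕ) :
    ‖cellTerm N m s n y r‖ ≤
      cellMajorant N m r * (modeConst y * Real.exp (-(π * |(n : ℝ)| * y))) := by
  rcases eq_or_ne r 0 with rfl | hr
  · simp [cellMajorant]
  rw [cellTerm_of_ne_zero m s n y hr, norm_mul]
  have hA : 0 ≤ (m : ℝ) / ((N * r : ℕ) : ℝ) ^ 2 := by positivity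
  exact mul_le_mul (norm_cell_arith_le hm hs0 n hr)
    (norm_modeIntegral_le_modeConst hs0 hs1 hA hy _) (norm_nonneg _) (cellMajorant_nonneg m r)

/-- The majorant of the `r`-series is summable. [cite: IwaniecKowalski2004, §14.2 (proof of Lemma 14.2)] -/
theorem summable_norm_cellTerm {m : ℕ} (hm : 1 ≤ m) {s : ℝ} (hs0 : 0 ≤ s) (hs1 : s ≤ 1) (n : ℤ)
    {y : ℝ} (hy : 0 < y) : Summable fun r : ℕ ↦ ‖cellTerm N m s n y r‖ :=
  ((summable_cellMajorant N m).mul_right _).of_nonneg_of_le (fun _ ↦ norm_nonneg _)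
    (fun r ↦ norm_cellTerm_le hm hs0 hs1 n hy r)

/-- **The size of a mode, uniformly in `0 ≤ s ≤ 1`:**
`‖fourierMode N m s n y‖ ≤ (1 + (Σ_r cellMajorant N m r) · modeConst y) · e^{−π|n|y}`
(the diagonal term `e^{−2πmy} ≤ e^{−πmy}`). [cite: IwaniecKowalski2004, §14.2 (proof of Lemma 14.2)] -/
theorem norm_fourierMode_le {m : ℕ} (hm : 1 ≤ m) {s : ℝ} (hs0 : 0 ≤ s) (hs1 : s ≤ 1) (n : ℤ)
    {y : ℝ} (hy : 0 < y) :
    ‖fourierMode N m s n y‖ ≤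
      (1 + (∑' r : ℕ, cellMajorant N m r) * modeConst y) * Real.exp (-(π * |(n : ℝ)| * y)) := by
  have hδ : ‖(if n = (m : ℤ) then cexp (-(2 * π * m * y)) else 0 : ℂ)‖ ≤
      Real.exp (-(π * |(n : ℝ)| * y)) := by
    split_ifs with h
    · rw [Complex.norm_exp]
      have : (-(2 * π * (m : ℂ) * (y : ℂ))).re = -(2 * π * m * y) := by
        simp [Complex.mul_re]
      rw [this, h]
      push_cast
      rw [abs_of_nonneg (by positivity : (0 : ℝ) ≤ m)]
      have : 0 ≤ π * m * y := by positivity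
      exact Real.exp_le_exp.mpr (by linarith)
    · rw [norm_zero]; positivity
  have hS : ‖∑' r : ℕ, cellTerm N m s n y r‖ ≤
      (∑' r : ℕ, cellMajorant N m r) * (modeConst y * Real.exp (-(π * |(n : ℝ)| * y))) := by
    refine (norm_tsum_le_tsum_norm (summable_norm_cellTerm hm hs0 hs1 n hy)).trans ?_
    rw [← tsum_mul_right]
    exact (summable_norm_cellTerm hm hs0 hs1 n hy).tsum_le_tsum (fun r ↦ norm_cellTerm_le hm hs0 hs1 n hy r)
      ((summable_cellMajorant N m).mul_right _)
  unfold fourierMode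
  refine (norm_add_le _ _).trans ?_
  calc ‖(if n = (m : ℤ) then cexp (-(2 * π * m * y)) else 0 : ℂ)‖ + ‖∑' r : ℕ, cellTerm N m s n y r‖
      ≤ Real.exp (-(π * |(n : ℝ)| * y)) +
          (∑' r : ℕ, cellMajorant N m r) * (modeConst y * Real.exp (-(π * |(n : ℝ)| * y))) :=
        add_le_add hδ hS
    _ = (1 + (∑' r : ℕ, cellMajorant N m r) * modeConst y) * Real.exp (-(π * |(n : ℝ)| * y)) := by
        ring

omit [NeZero N] in
/-- `n ↦ K e^{−π|n|y}` is summable over `ℤ` (`y > 0`). [folklore] -/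
private theorem summable_exp_neg_abs (K : ℝ) {y : ℝ} (hy : 0 < y) :
    Summable fun n : ℤ ↦ K * Real.exp (-(π * |(n : ℝ)| * y)) := by
  have hq : Real.exp (-(π * y)) < 1 := Real.exp_lt_one_iff.mpr (by nlinarith [Real.pi_pos])
  have hq0 : 0 ≤ Real.exp (-(π * y)) := (Real.exp_pos _).le
  have hnat : Summable fun k : ℕ ↦ K * Real.exp (-(π * |((k : ℤ) : ℝ)| * y)) := by
    refine ((summable_geometric_of_lt_one hq0 hq).mul_left K).congr fun k ↦ ?_
    rw [← Real.exp_nat_mul]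
    congr 1
    push_cast
    rw [abs_of_nonneg (by positivity : (0 : ℝ) ≤ k)]
    ring
  refine Summable.of_nat_of_neg hnat ?_
  refine hnat.congr fun k ↦ ?_
  push_cast
  rw [abs_neg]

/-! ## The limit `s → 0⁺` of a cell and of a mode -/

/-- Each cell is continuous in `s` at `0⁺`: `cellTerm N m s n y r → cellTerm N m 0 n y r`.
[cite: IwaniecKowalski2004, §14.2 (proof of Lemma 14.2) with §3.2] -/
theorem tendsto_cellTerm_nhdsGT_zero (m : ℕ) (n : ℤ) {y : ℝ} (hy : 0 < y) (r : ℕ) :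
    Tendsto (fun s : ℝ ↦ cellTerm N m s n y r) (𝓝[>] 0) (𝓝 (cellTerm N m 0 n y r)) := by
  rcases eq_or_ne r 0 with rfl | hr
  · simp only [cellTerm_zero]; exact tendsto_const_nhds
  simp only [cellTerm_of_ne_zero m _ n y hr]
  have hc : (0 : ℝ) < ((N * r : ℕ) : ℝ) := by
    exact_mod_cast Nat.pos_of_ne_zero (mul_ne_zero (NeZero.ne N) hr)
  have hpow : Tendsto (fun s : ℝ ↦ ((((N * r : ℕ) : ℝ) ^ (-(2 * s)) : ℝ) : ℂ)) (𝓝[>] 0)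
      (𝓝 ((((N * r : ℕ) : ℝ) ^ (-(2 * (0 : ℝ))) : ℝ) : ℂ)) := by
    have hcont : Continuous fun s : ℝ ↦ ((((N * r : ℕ) : ℝ) ^ (-(2 * s)) : ℝ) : ℂ) :=
      Complex.continuous_ofReal.comp ((Real.continuous_const_rpow hc.ne').comp (by fun_prop))
    exact tendsto_nhdsWithin_of_tendsto_nhds (hcont.tendsto 0)
  have hA : 0 ≤ (m : ℝ) / ((N * r : ℕ) : ℝ) ^ 2 := by positivity
  exact ((tendsto_const_nhds.mul hpow).mul tendsto_const_nhds).mul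
    (tendsto_modeIntegral_nhdsGT_zero hA hy _)

/-- **Each mode is continuous in `s` at `0⁺`** (Tannery over `r` with the cell majorant):
`fourierMode N m s n y → fourierMode N m 0 n y`. [cite: IwaniecKowalski2004, §14.2 (proof of Lemma 14.2) with §3.2] -/
theorem tendsto_fourierMode_nhdsGT_zero {m : ℕ} (hm : 1 ≤ m) (n : ℤ) {y : ℝ} (hy : 0 < y) :
    Tendsto (fun s : ℝ ↦ fourierMode N m s n y) (𝓝[>] 0) (𝓝 (fourierMode N m 0 n y)) := by
  unfold fourierMode
  refine tendsto_const_nhds.add ?_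
  refine tendsto_tsum_of_dominated_convergence
    (bound := fun r : ℕ ↦ cellMajorant N m r * (modeConst y * Real.exp (-(π * |(n : ℝ)| * y))))
    ((summable_cellMajorant N m).mul_right _) (fun r ↦ tendsto_cellTerm_nhdsGT_zero m n hy r) ?_
  filter_upwards [Ioo_mem_nhdsGT (zero_lt_one' ℝ)] with s hs
  exact fun r ↦ norm_cellTerm_le hm hs.1.le hs.2.le n hy r

/-! ## The modes at `s = 0` -/

/-- **The modes of non-positive frequency vanish at `s = 0`** (the cell integrals do, and there is
no diagonal term since `m ≥ 1`). [cite: IwaniecKowalski2004, Lemma 14.2 (no terms with n ≤ 0)] -/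
theorem fourierMode_zero_of_nonpos {m : ℕ} (hm : 1 ≤ m) {n : ℤ} (hn : n ≤ 0) {y : ℝ} (hy : 0 < y) :
    fourierMode N m 0 n y = 0 := by
  unfold fourierMode
  have hδ : ¬ n = (m : ℤ) := by omega
  rw [if_neg hδ, zero_add]
  refine (tsum_congr fun r ↦ ?_).trans tsum_zero
  rcases eq_or_ne r 0 with rfl | hr
  · exact cellTerm_zero m 0 n y
  rw [cellTerm_of_ne_zero m 0 n y hr,
    modeIntegral_zero_eq_zero_of_nonpos (by positivity) (by exact_mod_cast hn) hy, mul_zero]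

/-- **The cells of positive frequency at `s = 0` are Kowalski–Michel's Kloosterman–Bessel terms:**
for `m, k ≥ 1`, `cellTerm N m 0 k y r = −(2π/N)(√k/√m) e^{−2πky} · (r⁻¹ S(m,k;Nr) J₁(4π√(mk)/(Nr)))`.
[cite: IwaniecKowalski2004, §14.2 (proof of Lemma 14.2)] [cite: KowalskiMichel2000, §2.4.2 p. 312 (J(l₁,l₂))] -/
theorem cellTerm_zero_natCast {m : ℕ} (hm : 1 ≤ m) {k : ℕ} (hk : 1 ≤ k) {y : ℝ} (hy : 0 < y) (r : ℕ) :
    cellTerm N m 0 (k : ℤ) y r =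
      -(((2 * π / N * (Real.sqrt k / Real.sqrt m) : ℝ) : ℂ) * cexp (-(2 * π * k * y : ℝ))) *
        petKloostermanTerm N m k r := by
  rcases eq_or_ne r 0 with rfl | hr
  · simp
  haveI : NeZero (N * r) := ⟨mul_ne_zero (NeZero.ne N) hr⟩
  have hN : (0 : ℝ) < N := by exact_mod_cast Nat.pos_of_ne_zero (NeZero.ne N)
  have hr0 : (0 : ℝ) < r := by exact_mod_cast Nat.pos_of_ne_zero hr
  have hm0 : (0 : ℝ) < m := by exact_mod_cast hm
  have hk0 : (0 : ℝ) < k := by exact_mod_cast hk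
  have hc : (0 : ℝ) < ((N * r : ℕ) : ℝ) := by push_cast; positivity
  have hA : 0 < (m : ℝ) / ((N * r : ℕ) : ℝ) ^ 2 := by positivity
  rw [cellTerm_of_ne_zero m 0 (k : ℤ) y hr, petKloostermanTerm_of_ne_zero N m k hr]
  have hB : (((k : ℕ) : ℤ) : ℝ) = (k : ℝ) := by push_cast; ring
  rw [show modeIntegral 0 ((m : ℝ) / ((N * r : ℕ) : ℝ) ^ 2) (((k : ℕ) : ℤ) : ℝ) y =
      modeIntegral 0 ((m : ℝ) / ((N * r : ℕ) : ℝ) ^ 2) (k : ℝ) y by rw [hB],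
    modeIntegral_zero_eq_of_pos hA hk0 hy]
  -- the square roots
  have hsq1 : Real.sqrt ((k : ℝ) / ((m : ℝ) / ((N * r : ℕ) : ℝ) ^ 2)) =
      ((N * r : ℕ) : ℝ) * Real.sqrt k / Real.sqrt m := by
    rw [show (k : ℝ) / ((m : ℝ) / ((N * r : ℕ) : ℝ) ^ 2) = (((N * r : ℕ) : ℝ) ^ 2 * k) / m by
        field_simp,
      Real.sqrt_div' _ hm0.le, Real.sqrt_mul (by positivity), Real.sqrt_sq hc.le]
  have hsq2 : Real.sqrt ((m : ℝ) / ((N * r : ℕ) : ℝ) ^ 2 * k) =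
      Real.sqrt ((m : ℝ) * k) / ((N * r : ℕ) : ℝ) := by
    rw [show (m : ℝ) / ((N * r : ℕ) : ℝ) ^ 2 * k = ((m : ℝ) * k) / ((N * r : ℕ) : ℝ) ^ 2 by ring,
      Real.sqrt_div' _ (by positivity), Real.sqrt_sq hc.le]
  rw [hsq1, hsq2]
  -- casts: `((m : ℤ) : ZMod)` = `(m : ZMod)`, `(Nr)^0 = 1`
  have hz1 : (((m : ℤ) : ZMod (N * r))) = (m : ZMod (N * r)) := by push_cast; ring
  have hz2 : ((((k : ℕ) : ℤ) : ZMod (N * r))) = (k : ZMod (N * r)) := by push_cast; ring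
  rw [hz1, hz2]
  have h0 : (((((N * r : ℕ) : ℝ)) ^ (-(2 * (0 : ℝ))) : ℝ) : ℂ) = 1 := by simp
  rw [h0, mul_one]
  have hNC : (N : ℂ) ≠ 0 := by exact_mod_cast hN.ne'
  have hrC : (r : ℂ) ≠ 0 := by exact_mod_cast hr0.ne'
  have hmC : ((Real.sqrt m : ℝ) : ℂ) ≠ 0 := by exact_mod_cast (Real.sqrt_pos.mpr hm0).ne'
  push_cast
  field_simp

/-- **The `r`-sum of the cells at `s = 0`, positive frequency:**
`Σ_r cellTerm N m 0 k y r = −(√k/√m) e^{−2πky} J_N(m,k)` with `J_N = petJ N`.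
[cite: IwaniecKowalski2004, Lemma 14.2 (k = 2)] [cite: KowalskiMichel2000, §2.4.2 p. 312 (J(l₁,l₂))] -/
theorem tsum_cellTerm_zero_natCast {m : ℕ} (hm : 1 ≤ m) {k : ℕ} (hk : 1 ≤ k) {y : ℝ} (hy : 0 < y) :
    ∑' r : ℕ, cellTerm N m 0 (k : ℤ) y r =
      -(((Real.sqrt k / Real.sqrt m : ℝ) : ℂ) * cexp (-(2 * π * k * y : ℝ))) * petJ N m k := by
  simp_rw [cellTerm_zero_natCast hm hk hy]
  rw [tsum_mul_left, Literature.NumberTheory.LFunctions.KowalskiMichel2000.petJ_def]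
  push_cast
  ring

/-- **The modes at `s = 0` are the printed coefficients:** for `k ≥ 1` and `z = x + iy`,
`fourierMode N m 0 k y · e(kx) = poincareCoeff N m k · e(kz)`.
[cite: IwaniecKowalski2004, Lemma 14.2 (k = 2)] -/
theorem fourierMode_zero_natCast_mul_cexp {m : ℕ} (hm : 1 ≤ m) {k : ℕ} (hk : 1 ≤ k) (z : ℍ) :
    fourierMode N m 0 (k : ℤ) z.im * cexp (2 * π * I * k * (z.re : ℂ)) =
      poincareCoeff N m k * cexp (2 * π * I * k * (z : ℂ)) := by
  have hy : 0 < z.im := z.im_pos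
  have hz : (z : ℂ) = (z.re : ℂ) + (z.im : ℂ) * I := (Complex.re_add_im _).symm
  have hsplit : cexp (2 * π * I * k * (z : ℂ)) =
      cexp (-(2 * π * k * z.im : ℝ)) * cexp (2 * π * I * k * (z.re : ℂ)) := by
    rw [← Complex.exp_add, hz]
    congr 1
    push_cast
    linear_combination (2 * π * k * z.im : ℂ) * Complex.I_sq
  unfold fourierMode
  rw [tsum_cellTerm_zero_natCast hm hk hy, poincareCoeff, hsplit]
  by_cases h : m = k
  · subst h
    simp only [if_true]
    push_cast
    ring
  · have h' : ¬ ((m : ℕ) : ℤ) = (m : ℤ) ∨ True := Or.inr trivial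
    rw [if_neg (by exact_mod_cast (Ne.symm h)), if_neg h]
    push_cast
    ring

/-! ## Fourier inversion on the horocycle `Im z = y` for `s > 0` -/

omit [NeZero N] in
/-- `T ∈ Γ₀(N)`. [folklore] -/
private theorem T_mem_Gamma0 : ModularGroup.T ∈ Gamma0 N := by
  rw [Gamma0_mem, ModularGroup.coe_T]
  simp

/-- The point `x + iy` of `ℍ`. [cite: IwaniecKowalski2004, §14.2 (proof of Lemma 14.2)] -/
private def pt (x : ℝ) {y : ℝ} (hy : 0 < y) : ℍ := ⟨(x : ℂ) + y * I, by simp [hy]⟩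

omit [NeZero N] in
/-- The underlying complex number of `pt x hy` is `x + iy`. [folklore] -/
private theorem pt_coe (x : ℝ) {y : ℝ} (hy : 0 < y) : ((pt x hy : ℍ) : ℂ) = (x : ℂ) + y * I := rfl

omit [NeZero N] in
/-- `ofComplex (x + iy) = pt x hy` for `y > 0`. [folklore] -/
private theorem ofComplex_eq_pt (x : ℝ) {y : ℝ} (hy : 0 < y) :
    UpperHalfPlane.ofComplex ((x : ℂ) + y * I) = pt x hy :=
  UpperHalfPlane.ofComplex_apply_of_im_pos (by simp [hy])

omit [NeZero N] in
/-- `x + iy` lies in the vertical strip `|Re| ≤ R`, `Im ≥ y` when `|x| ≤ R`. [folklore] -/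
private theorem pt_mem_verticalStrip {y : ℝ} (hy : 0 < y) {R x : ℝ} (hx : |x| ≤ R) :
    pt x hy ∈ verticalStrip R y := by
  rw [mem_verticalStrip_iff]
  exact ⟨by simpa [pt, UpperHalfPlane.re] using hx, by simp [pt, UpperHalfPlane.im]⟩

omit [NeZero N] in
/-- **Periodicity**: `P_m((x+1)+iy, s) = P_m(x+iy, s)` (automorphy under `T ∈ Γ₀(N)`, `j_T = 1`).
[cite: IwaniecKowalski2004, §14.1 (14.4)] -/
private theorem poincareHecke_pt_add_one (m : ℕ) (s : ℝ) {y : ℝ} (hy : 0 < y) (x : ℝ) :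
    poincareHecke N m s (pt (x + 1) hy) = poincareHecke N m s (pt x hy) := by
  have hT : pt (x + 1) hy = ModularGroup.T • pt x hy := by
    rw [UpperHalfPlane.modular_T_smul]
    ext1
    rw [UpperHalfPlane.coe_vadd, pt_coe, pt_coe]
    push_cast; ring
  rw [hT, poincareHecke_smul m s ModularGroup.T T_mem_Gamma0]
  simp [rowDenom, ModularGroup.coe_T]

omit [NeZero N] in
/-- One term of the series is continuous along the horocycle. [cite: IwaniecKowalski2004, §14.1 (14.4)] -/
private theorem continuous_poincareTerm_pt (m : ℕ) (s : ℝ) (v : Row N) {y : ℝ} (hy : 0 < y) :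
    Continuous fun x : ℝ ↦ poincareTerm N m s v (pt x hy) := by
  have hden : Continuous fun x : ℝ ↦ rowDenom v.1 (pt x hy) := by
    unfold rowDenom; simp only [pt_coe]; fun_prop
  have hne : ∀ x : ℝ, rowDenom v.1 (pt x hy) ≠ 0 := fun x ↦ rowDenom_ne_zero v.1 v.2.1 _
  unfold poincareTerm
  refine ((Continuous.inv₀ (hden.pow 2) fun x ↦ pow_ne_zero 2 (hne x)).mul ?_).mul ?_
  · exact Complex.continuous_ofReal.comp
      ((continuous_norm.comp hden).rpow_const fun x ↦ Or.inl (norm_ne_zero_iff.mpr (hne x)))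
  · refine Complex.continuous_exp.comp (continuous_const.mul ?_)
    -- `γ_v • z = (a z + b)/(c z + d)` with non-vanishing denominator
    have hnum : Continuous fun x : ℝ ↦
        ((rowMatrix v.1 v.2.1 0 0 : ℤ) : ℂ) * ((pt x hy : ℍ) : ℂ) + ((rowMatrix v.1 v.2.1 0 1 : ℤ) : ℂ) := by
      simp only [pt_coe]; fun_prop
    have hden' : Continuous fun x : ℝ ↦
        ((rowMatrix v.1 v.2.1 1 0 : ℤ) : ℂ) * ((pt x hy : ℍ) : ℂ) + ((rowMatrix v.1 v.2.1 1 1 : ℤ) : ℂ) := by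
      simp only [pt_coe]; fun_prop
    have hne' : ∀ x : ℝ,
        ((rowMatrix v.1 v.2.1 1 0 : ℤ) : ℂ) * ((pt x hy : ℍ) : ℂ) + ((rowMatrix v.1 v.2.1 1 1 : ℤ) : ℂ) ≠ 0 := by
      intro x
      have := hne x
      simpa [rowDenom, rowMatrix_apply_one_zero, rowMatrix_apply_one_one] using this
    have h := hnum.div hden' hne'
    refine h.congr fun x ↦ ?_
    rw [UpperHalfPlane.coe_specialLinearGroup_apply]
    simp

omit [NeZero N] in
/-- **Continuity along the horocycle**: `x ↦ P_m(x+iy, s)` is continuous on `|x| ≤ R` for `s > 0`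
(the Eisenstein majorant `|cz+d|^{−(2+2s)} ≤ r(R,y)^{−(2+2s)} ‖(c,d)‖^{−(2+2s)}` on the vertical
strip, Mathlib `EisensteinSeries.summand_bound_of_mem_verticalStrip`). [cite: IwaniecKowalski2004, §14.1 (14.4)–(14.5)] -/
private theorem continuousOn_poincareHecke_pt (m : ℕ) {s : ℝ} (hs : 0 < s) {y : ℝ} (hy : 0 < y)
    (R : ℝ) : ContinuousOn (fun x : ℝ ↦ poincareHecke N m s (pt x hy)) (Icc (-R) R) := by
  have hk : 0 ≤ 2 + 2 * s := by linarith
  set u : Row N → ℝ := fun v ↦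
    EisensteinSeries.r ⟨⟨R, y⟩, hy⟩ ^ (-(2 + 2 * s)) * ‖v.1‖ ^ (-(2 + 2 * s)) with hu
  have hsum : Summable u := by
    have h := (EisensteinSeries.summable_one_div_norm_rpow (by linarith : 2 < 2 + 2 * s)).mul_left
      (EisensteinSeries.r ⟨⟨R, y⟩, hy⟩ ^ (-(2 + 2 * s)))
    exact h.subtype _
  have hterm : ContinuousOn (fun x : ℝ ↦ ∑' v : Row N, poincareTerm N m s v (pt x hy)) (Icc (-R) R) := by
    refine continuousOn_tsum (fun v ↦ (continuous_poincareTerm_pt m s v hy).continuousOn) hsum ?_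
    intro v x hx
    have hstrip : pt x hy ∈ verticalStrip R y := pt_mem_verticalStrip hy (abs_le.mpr hx)
    refine (norm_poincareTerm_le m s v _).trans ?_
    have h := EisensteinSeries.summand_bound_of_mem_verticalStrip hk v.1 hy hstrip
    simpa [rowDenom, hu] using h
  unfold poincareHecke
  exact continuousOn_const.mul hterm

/-- **Fourier inversion on the horocycle.** If the Fourier coefficients of `x ↦ P_m(x+iy,s)` over
`[0,1]` are the printed modes (hypothesis T2 at this `s > 0`, `y`), then
`P_m(z,s) = Σ_{n ∈ ℤ} fourierMode N m s n y · e(nx)` for `z = x + iy` (the modes are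
`O(e^{−π|n|y})`, so the Fourier series converges pointwise: Mathlib
`has_pointwise_sum_fourier_series_of_summable`). [cite: IwaniecKowalski2004, §14.2 (proof of Lemma 14.2)] -/
theorem hasSum_fourierMode {m : ℕ} (hm : 1 ≤ m) {s : ℝ} (hs : 0 < s) (hs1 : s ≤ 1) (z : ℍ)
    (hmodes : ∀ n : ℤ,
      ∫ x in (0 : ℝ)..1, poincareHecke N m s (UpperHalfPlane.ofComplex ((x : ℂ) + z.im * I)) *
          cexp (-(2 * π * I * n * x)) = fourierMode N m s n z.im) :
    HasSum (fun n : ℤ ↦ fourierMode N m s n z.im * cexp (2 * π * I * n * (z.re : ℂ)))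
      (poincareHecke N m s z) := by
  have hy : 0 < z.im := z.im_pos
  -- the horocycle function and its lift to the circle
  set f : ℝ → ℂ := fun x ↦ poincareHecke N m s (UpperHalfPlane.ofComplex ((x : ℂ) + z.im * I))
    with hf
  have hfpt : ∀ x, f x = poincareHecke N m s (pt x hy) := fun x ↦ by
    simp only [hf, ofComplex_eq_pt x hy]
  have hper : Function.Periodic f 1 := fun x ↦ by
    rw [hfpt, hfpt, poincareHecke_pt_add_one]
  have hcont : ContinuousOn f (Icc 0 1) := by
    have h := continuousOn_poincareHecke_pt (N := N) m hs hy 1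
    refine (h.mono fun x hx ↦ ⟨by linarith [hx.1], hx.2⟩).congr fun x _ ↦ hfpt x
  set F : C(AddCircle (1 : ℝ), ℂ) :=
    ⟨AddCircle.liftIco 1 0 f, AddCircle.liftIco_zero_continuous (by simpa using (hper 0).symm) hcont⟩
    with hF
  -- `F ↑x = f x` for every real `x`
  have hFx : ∀ x : ℝ, F (x : AddCircle (1 : ℝ)) = f x := by
    intro x
    have hfrac : (x : AddCircle (1 : ℝ)) = ((Int.fract x : ℝ) : AddCircle (1 : ℝ)) := by
      rw [Int.fract, AddCircle.coe_sub]
      have : ((⌊x⌋ : ℝ) : AddCircle (1 : ℝ)) = 0 := by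
        rw [AddCircle.coe_eq_zero_iff]
        exact ⟨⌊x⌋, by simp⟩
      rw [this, sub_zero]
    have hmem : Int.fract x ∈ Ico (0 : ℝ) 1 := ⟨Int.fract_nonneg x, Int.fract_lt_one x⟩
    rw [hfrac]
    change AddCircle.liftIco 1 0 f _ = _
    rw [AddCircle.liftIco_zero_coe_apply hmem, Int.fract]
    simpa using hper.sub_int_mul_eq ⌊x⌋ (x := x)
  -- the Fourier coefficients of `F` are the modes
  have hcoeff : ∀ n : ℤ, fourierCoeff F n = fourierMode N m s n z.im := by
    intro n
    rw [fourierCoeff_eq_intervalIntegral F n 0, zero_add, ← hmodes n]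
    simp only [one_div, inv_one, one_smul]
    refine intervalIntegral.integral_congr fun x _ ↦ ?_
    rw [fourier_coe_apply, hFx x, smul_eq_mul, mul_comm]
    congr 1
    congr 1
    push_cast
    ring
  have hsumm : Summable (fourierCoeff F) := by
    refine Summable.of_norm_bounded (summable_exp_neg_abs
      (1 + (∑' r : ℕ, cellMajorant N m r) * modeConst z.im) hy) fun n ↦ ?_
    rw [hcoeff n]
    exact norm_fourierMode_le hm hs.le hs1 n hy
  have key := has_pointwise_sum_fourier_series_of_summable hsumm (z.re : AddCircle (1 : ℝ))
  have hFz : F (z.re : AddCircle (1 : ℝ)) = poincareHecke N m s z := by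
    rw [hFx, hfpt]
    congr 1
    ext1
    rw [pt_coe]
    exact (Complex.re_add_im _)
  rw [hFz] at key
  refine key.congr_fun fun n ↦ ?_
  rw [hcoeff n, fourier_coe_apply, smul_eq_mul]
  congr 1
  push_cast
  ring_nf

/-! ## Hecke's limit -/

/-- **T3 of the I1 skeleton `poincare_hecke` (`stub_heckeLimit : HeckeFourierModes → HeckeLimit`),
PROVED.** If, for all `N, m ≥ 1, s > 0, n ∈ ℤ, y > 0`, the Fourier modes of `P_m(·+iy, s)` over
`[0,1]` are the printed ones (`δ_{mn}e^{−2πmy} + Σ_r (Nr)^{−2−2s}S(m,n;Nr)I_s(m/(Nr)²,n;y)`, the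
`r`-series converging absolutely), then **Hecke's limit holds pointwise**:
`P_m(z,s) → Σ_{n≥1} p_m(n) e(nz) = poincareQSeries N m z` as `s → 0⁺`, with
`p_m(n) = poincareCoeff N m n = δ(m,n) − √n/√m · J_N(m,n)` (Iwaniec–Kowalski Lemma 14.2 at `k = 2`
via Hecke's trick: Fourier inversion on the horocycle, Tannery in `n` and `r` by Weil's bound and
the `e^{−π|n|y}` decay of the cells, Lipschitz–Hankel at `s = 0`).
[cite: IwaniecKowalski2004, Lemma 14.2 (k = 2, Hecke's trick §3.2)] -/
theorem heckeLimit_of_fourierModes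
    (hT2 : ∀ (N : ℕ) [NeZero N] (m : ℕ), 1 ≤ m → ∀ (s : ℝ), 0 < s → ∀ (n : ℤ) (y : ℝ), 0 < y →
      Summable (fun r : ℕ ↦ ‖cellTerm N m s n y r‖) ∧
      ∫ x in (0 : ℝ)..1, poincareHecke N m s (UpperHalfPlane.ofComplex ((x : ℂ) + y * I)) *
          cexp (-(2 * π * I * n * x)) =
        (if n = (m : ℤ) then cexp (-(2 * π * m * y)) else 0) + ∑' r : ℕ, cellTerm N m s n y r) :
    ∀ (N : ℕ) [NeZero N] (m : ℕ), 1 ≤ m → ∀ z : ℍ,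
      Tendsto (fun s : ℝ ↦ poincareHecke N m s z) (𝓝[>] 0) (𝓝 (poincareQSeries N m z)) := by
  intro N _ m hm z
  have hy : 0 < z.im := z.im_pos
  -- (1) Fourier inversion for `0 < s ≤ 1`
  have h1 : ∀ s : ℝ, 0 < s → s ≤ 1 → poincareHecke N m s z =
      ∑' n : ℤ, fourierMode N m s n z.im * cexp (2 * π * I * n * (z.re : ℂ)) := by
    intro s hs hs1
    exact (hasSum_fourierMode hm hs hs1 z (fun n ↦ (hT2 N m hm s hs n z.im hy).2)).tsum_eq.symm
  -- (2) Tannery over `n ∈ ℤ`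
  have h2 : Tendsto (fun s : ℝ ↦ ∑' n : ℤ, fourierMode N m s n z.im * cexp (2 * π * I * n * (z.re : ℂ)))
      (𝓝[>] 0) (𝓝 (∑' n : ℤ, fourierMode N m 0 n z.im * cexp (2 * π * I * n * (z.re : ℂ)))) := by
    refine tendsto_tsum_of_dominated_convergence
      (bound := fun n : ℤ ↦ (1 + (∑' r : ℕ, cellMajorant N m r) * modeConst z.im) *
        Real.exp (-(π * |(n : ℝ)| * z.im)))
      (summable_exp_neg_abs _ hy) (fun n ↦ (tendsto_fourierMode_nhdsGT_zero hm n hy).mul tendsto_const_nhds) ?_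
    filter_upwards [Ioo_mem_nhdsGT (zero_lt_one' ℝ)] with s hs
    intro n
    rw [norm_mul, show (2 * π * I * n * (z.re : ℂ)) = ((2 * π * n * z.re : ℝ) : ℂ) * I by push_cast; ring,
      Complex.norm_exp_ofReal_mul_I, mul_one]
    exact norm_fourierMode_le hm hs.1.le hs.2.le n hy
  -- (3) the limit series is the printed `q`-series
  have h3 : ∑' n : ℤ, fourierMode N m 0 n z.im * cexp (2 * π * I * n * (z.re : ℂ)) =
      poincareQSeries N m z := by
    have hneg : ∀ k : ℕ, fourierMode N m 0 (-(k + 1 : ℤ)) z.im *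
        cexp (2 * π * I * ((-(k + 1) : ℤ) : ℂ) * (z.re : ℂ)) = 0 := fun k ↦ by
      rw [fourierMode_zero_of_nonpos hm (by omega) hy, zero_mul]
    have hnat : ∀ k : ℕ, fourierMode N m 0 (k : ℤ) z.im * cexp (2 * π * I * ((k : ℤ) : ℂ) * (z.re : ℂ)) =
        (if k = 0 then 0 else poincareCoeff N m k * cexp (2 * π * I * k * (z : ℂ))) := by
      intro k
      rcases Nat.eq_zero_or_pos k with rfl | hk
      · simp only [if_true, Nat.cast_zero]
        rw [fourierMode_zero_of_nonpos hm le_rfl hy, zero_mul]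
      · rw [if_neg hk.ne', Int.cast_natCast]
        exact fourierMode_zero_natCast_mul_cexp hm hk z
    have hsNat : Summable fun k : ℕ ↦
        fourierMode N m 0 (k : ℤ) z.im * cexp (2 * π * I * ((k : ℤ) : ℂ) * (z.re : ℂ)) := by
      refine Summable.of_norm_bounded ((summable_exp_neg_abs
        (1 + (∑' r : ℕ, cellMajorant N m r) * modeConst z.im) hy).comp_injective Nat.cast_injective)
        fun k ↦ ?_
      show _ ≤ (1 + (∑' r : ℕ, cellMajorant N m r) * modeConst z.im) *
        Real.exp (-(π * |((k : ℤ) : ℝ)| * z.im))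
      rw [norm_mul, show (2 * π * I * ((k : ℤ) : ℂ) * (z.re : ℂ)) = ((2 * π * k * z.re : ℝ) : ℂ) * I by
        push_cast; ring, Complex.norm_exp_ofReal_mul_I, mul_one]
      exact norm_fourierMode_le hm le_rfl zero_le_one _ hy
    have hsNeg : Summable fun k : ℕ ↦ fourierMode N m 0 (-(k + 1 : ℤ)) z.im *
        cexp (2 * π * I * ((-(k + 1) : ℤ) : ℂ) * (z.re : ℂ)) := by
      simp_rw [hneg]; exact summable_zero
    rw [tsum_of_nat_of_neg_add_one
      (f := fun n : ℤ ↦ fourierMode N m 0 n z.im * cexp (2 * π * I * n * (z.re : ℂ))) hsNat hsNeg]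
    simp_rw [hneg, tsum_zero, add_zero]
    unfold poincareQSeries
    exact tsum_congr hnat
  -- assemble
  rw [← h3]
  refine h2.congr' ?_
  filter_upwards [Ioc_mem_nhdsGT (zero_lt_one' ℝ)] with s hs
  exact (h1 s hs.1 hs.2).symm

end Fixed

/-! ## The modes and the pointwise expansion for every `s > 0`; the size of `P_m(z,s)` towards
the cusp `∞` (appended for stub T4a `stub_heckeDomination` of the I1 skeleton: the bounds above
without the restriction `s ≤ 1`, keeping the factor `(y/2)^{−2s}` of the cell integral) -/

section AllS

variable {N : ℕ} [NeZero N]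

/-- **The size of a mode for every `s ≥ 0`:**
`‖fourierMode N m s n y‖ ≤ δ_{nm} e^{−2πmy} + (Σ_r cellMajorant N m r)·(2π/y)(y/2)^{−2s}·e^{−π|n|y}`.
[cite: IwaniecKowalski2004, §14.2 (proof of Lemma 14.2)] -/
theorem norm_fourierMode_le_of_nonneg {m : ℕ} (hm : 1 ≤ m) {s : ℝ} (hs : 0 ≤ s) (n : ℤ) {y : ℝ}
    (hy : 0 < y) :
    ‖fourierMode N m s n y‖ ≤
      (if n = (m : ℤ) then Real.exp (-(2 * π * m * y)) else 0) +
        (∑' r : ℕ, cellMajorant N m r) * (2 * π / y * (y / 2) ^ (-(2 * s))) *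
          Real.exp (-(π * |(n : ℝ)| * y)) := by
  set K : ℝ := 2 * π / y * (y / 2) ^ (-(2 * s)) * Real.exp (-(π * |(n : ℝ)| * y)) with hK
  have hcell : ∀ r : ℕ, ‖cellTerm N m s n y r‖ ≤ cellMajorant N m r * K := by
    intro r
    rcases eq_or_ne r 0 with rfl | hr
    · simp [cellMajorant]
    rw [cellTerm_of_ne_zero m s n y hr, norm_mul]
    have hA : 0 ≤ (m : ℝ) / ((N * r : ℕ) : ℝ) ^ 2 := by positivity
    exact mul_le_mul (norm_cell_arith_le hm hs n hr) (norm_modeIntegral_le hs hA hy _) (norm_nonneg _)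
      (cellMajorant_nonneg m r)
  have hsum : Summable fun r : ℕ ↦ ‖cellTerm N m s n y r‖ :=
    ((summable_cellMajorant N m).mul_right K).of_nonneg_of_le (fun _ ↦ norm_nonneg _) hcell
  have hS : ‖∑' r : ℕ, cellTerm N m s n y r‖ ≤ (∑' r : ℕ, cellMajorant N m r) * K := by
    refine (norm_tsum_le_tsum_norm hsum).trans ?_
    rw [← tsum_mul_right]
    exact hsum.tsum_le_tsum hcell ((summable_cellMajorant N m).mul_right K)
  have hδ : ‖(if n = (m : ℤ) then cexp (-(2 * π * m * y)) else 0 : ℂ)‖ ≤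
      (if n = (m : ℤ) then Real.exp (-(2 * π * m * y)) else 0) := by
    split_ifs with h
    · rw [Complex.norm_exp]
      have : (-(2 * π * (m : ℂ) * (y : ℂ))).re = -(2 * π * m * y) := by simp [Complex.mul_re]
      rw [this]
    · rw [norm_zero]
  unfold fourierMode
  refine (norm_add_le _ _).trans ?_
  calc ‖(if n = (m : ℤ) then cexp (-(2 * π * m * y)) else 0 : ℂ)‖ + ‖∑' r : ℕ, cellTerm N m s n y r‖
      ≤ (if n = (m : ℤ) then Real.exp (-(2 * π * m * y)) else 0) + (∑' r : ℕ, cellMajorant N m r) * K :=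
        add_le_add hδ hS
    _ = _ := by rw [hK]; ring

omit [NeZero N] in
/-- The majorant `n ↦ δ_{nm} a + K e^{−π|n|y}` is summable over `ℤ`. [folklore] -/
private theorem summable_delta_add_exp (m : ℕ) (a K : ℝ) {y : ℝ} (hy : 0 < y) :
    Summable fun n : ℤ ↦ (if n = (m : ℤ) then a else 0) + K * Real.exp (-(π * |(n : ℝ)| * y)) :=
  (hasSum_ite_eq (m : ℤ) a).summable.add (summable_exp_neg_abs K hy)

/-- **Fourier inversion on the horocycle for every `s > 0`** (as `hasSum_fourierMode`, the
summability of the modes now from `norm_fourierMode_le_of_nonneg`): if the Fourier coefficients of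
`x ↦ P_m(x+iy,s)` over `[0,1]` are the printed modes, then
`P_m(z,s) = Σ_{n ∈ ℤ} fourierMode N m s n y · e(nx)`, `z = x + iy`.
[cite: IwaniecKowalski2004, §14.2 (proof of Lemma 14.2)] -/
theorem hasSum_fourierMode_of_pos {m : ℕ} (hm : 1 ≤ m) {s : ℝ} (hs : 0 < s) (z : ℍ)
    (hmodes : ∀ n : ℤ,
      ∫ x in (0 : ℝ)..1, poincareHecke N m s (UpperHalfPlane.ofComplex ((x : ℂ) + z.im * I)) *
          cexp (-(2 * π * I * n * x)) = fourierMode N m s n z.im) :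
    HasSum (fun n : ℤ ↦ fourierMode N m s n z.im * cexp (2 * π * I * n * (z.re : ℂ)))
      (poincareHecke N m s z) := by
  have hy : 0 < z.im := z.im_pos
  set f : ℝ → ℂ := fun x ↦ poincareHecke N m s (UpperHalfPlane.ofComplex ((x : ℂ) + z.im * I))
    with hf
  have hfpt : ∀ x, f x = poincareHecke N m s (pt x hy) := fun x ↦ by
    simp only [hf, ofComplex_eq_pt x hy]
  have hper : Function.Periodic f 1 := fun x ↦ by
    rw [hfpt, hfpt, poincareHecke_pt_add_one]
  have hcont : ContinuousOn f (Icc 0 1) := by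
    have h := continuousOn_poincareHecke_pt (N := N) m hs hy 1
    refine (h.mono fun x hx ↦ ⟨by linarith [hx.1], hx.2⟩).congr fun x _ ↦ hfpt x
  set F : C(AddCircle (1 : ℝ), ℂ) :=
    ⟨AddCircle.liftIco 1 0 f, AddCircle.liftIco_zero_continuous (by simpa using (hper 0).symm) hcont⟩
    with hF
  have hFx : ∀ x : ℝ, F (x : AddCircle (1 : ℝ)) = f x := by
    intro x
    have hfrac : (x : AddCircle (1 : ℝ)) = ((Int.fract x : ℝ) : AddCircle (1 : ℝ)) := by
      rw [Int.fract, AddCircle.coe_sub]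
      have : ((⌊x⌋ : ℝ) : AddCircle (1 : ℝ)) = 0 := by
        rw [AddCircle.coe_eq_zero_iff]
        exact ⟨⌊x⌋, by simp⟩
      rw [this, sub_zero]
    have hmem : Int.fract x ∈ Ico (0 : ℝ) 1 := ⟨Int.fract_nonneg x, Int.fract_lt_one x⟩
    rw [hfrac]
    change AddCircle.liftIco 1 0 f _ = _
    rw [AddCircle.liftIco_zero_coe_apply hmem, Int.fract]
    simpa using hper.sub_int_mul_eq ⌊x⌋ (x := x)
  have hcoeff : ∀ n : ℤ, fourierCoeff F n = fourierMode N m s n z.im := by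
    intro n
    rw [fourierCoeff_eq_intervalIntegral F n 0, zero_add, ← hmodes n]
    simp only [one_div, inv_one, one_smul]
    refine intervalIntegral.integral_congr fun x _ ↦ ?_
    rw [fourier_coe_apply, hFx x, smul_eq_mul, mul_comm]
    congr 1
    congr 1
    push_cast
    ring
  have hsumm : Summable (fourierCoeff F) := by
    refine Summable.of_norm_bounded (summable_delta_add_exp m (Real.exp (-(2 * π * m * z.im)))
      ((∑' r : ℕ, cellMajorant N m r) * (2 * π / z.im * (z.im / 2) ^ (-(2 * s)))) hy) fun n ↦ ?_
    rw [hcoeff n]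
    exact norm_fourierMode_le_of_nonneg hm hs.le n hy
  have key := has_pointwise_sum_fourier_series_of_summable hsumm (z.re : AddCircle (1 : ℝ))
  have hFz : F (z.re : AddCircle (1 : ℝ)) = poincareHecke N m s z := by
    rw [hFx, hfpt]
    congr 1
    ext1
    rw [pt_coe]
    exact (Complex.re_add_im _)
  rw [hFz] at key
  refine key.congr_fun fun n ↦ ?_
  rw [hcoeff n, fourier_coe_apply, smul_eq_mul]
  congr 1
  push_cast
  ring_nf

/-- **The size of `P_m(z,s)` from its Fourier expansion, every `s > 0`:**
`‖P_m(z,s)‖ ≤ e^{−2πmy} + (Σ_r cellMajorant N m r)·(2π/y)(y/2)^{−2s}·Σ_{n∈ℤ} e^{−π|n|y}`, `y = Im z`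
— uniformly in `s`, the decay `(2π/y)(y/2)^{−2s}` being what makes `y^{1+s}|P_m(z,s)|` bounded towards
the cusp `∞`. [cite: IwaniecKowalski2004, §14.2 (proof of Lemma 14.2)] -/
theorem norm_poincareHecke_le_of_modes {m : ℕ} (hm : 1 ≤ m) {s : ℝ} (hs : 0 < s) (z : ℍ)
    (hmodes : ∀ n : ℤ,
      ∫ x in (0 : ℝ)..1, poincareHecke N m s (UpperHalfPlane.ofComplex ((x : ℂ) + z.im * I)) *
          cexp (-(2 * π * I * n * x)) = fourierMode N m s n z.im) :
    ‖poincareHecke N m s z‖ ≤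
      Real.exp (-(2 * π * m * z.im)) +
        (∑' r : ℕ, cellMajorant N m r) * (2 * π / z.im * (z.im / 2) ^ (-(2 * s))) *
          ∑' n : ℤ, Real.exp (-(π * |(n : ℝ)| * z.im)) := by
  have hy : 0 < z.im := z.im_pos
  set K : ℝ := (∑' r : ℕ, cellMajorant N m r) * (2 * π / z.im * (z.im / 2) ^ (-(2 * s))) with hK
  have h := hasSum_fourierMode_of_pos hm hs z hmodes
  rw [← h.tsum_eq]
  have hbd : ∀ n : ℤ, ‖fourierMode N m s n z.im * cexp (2 * π * I * n * (z.re : ℂ))‖ ≤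
      (if n = (m : ℤ) then Real.exp (-(2 * π * m * z.im)) else 0) +
        K * Real.exp (-(π * |(n : ℝ)| * z.im)) := by
    intro n
    rw [norm_mul, show (2 * π * I * n * (z.re : ℂ)) = ((2 * π * n * z.re : ℝ) : ℂ) * I by push_cast; ring,
      Complex.norm_exp_ofReal_mul_I, mul_one]
    exact norm_fourierMode_le_of_nonneg hm hs.le n hy
  have hG := summable_delta_add_exp m (Real.exp (-(2 * π * m * z.im))) K hy
  have hsn : Summable fun n : ℤ ↦ ‖fourierMode N m s n z.im * cexp (2 * π * I * n * (z.re : ℂ))‖ :=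
    hG.of_nonneg_of_le (fun _ ↦ norm_nonneg _) hbd
  refine (norm_tsum_le_tsum_norm hsn).trans ((hsn.tsum_le_tsum hbd hG).trans (le_of_eq ?_))
  rw [(hasSum_ite_eq (m : ℤ) _).summable.tsum_add (summable_exp_neg_abs K hy), tsum_ite_eq,
    tsum_mul_left]

end AllS

end Literature.NumberTheory.ModularForms.PoincareWeightTwo

end
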